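import Mathlib
import Summits.ResolutionOfSingularities.ResolutionOfSingularities.Theorems.HomologicalConductorPersistenceKC3CompletionXY
import Summits.ResolutionOfSingularities.ResolutionOfSingularities.Theorems.HomologicalConductorPersistenceBranchedCoverLift
import HarnessLib

/-!
# K-C3 K2-LOWER without any named fact: `(x, y, z², zt, t²)·L ⊆ ca(L)` from the curve-side bound alone
# (W4.4b K-C3 §H2L, res-L1-w44b-plan-1 g13 CUT/GO 13:32:45Z (7))

Route `ResolutionOfSingularities/HomologicalConductor`, chain W4.4b (cell `res-hironaka`), crux `Persistence`
(stmt-ResolutionOfSingularities-16484), KILL CANDIDATE K-C3.  [OURS; AI-written, weaker than expert review; NOT a statement of the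
manuscript under study (Hironaka 2017); NO named fact is used in this file — everything is PROVED, the only non-structural
hypothesis left is the curve-side bound `hJ`.]

`…PersistenceKC3Completion.span_le_cohomologyAnnihilator_of_isLocalization` (p530272) and its `xy`-form
`…_of_isLocalization_xy` (p532075) gave K2-LOWER at every local ring `L` of `A = k[x,y,z,t]/(xy − h)` at the origin MODULO the
named fact `doubleBranchedCover_map_cohomologyAnnihilator_eq` ([Esentepe2020, Thm. 5.4], both halves) and the curve-side EQUALITY
`hca : ca(k⟦z,t⟧/(h)) = (z,t)²`.  `…PersistenceBranchedCoverLift` (p534509, on res-L1-w44b-stub-2's quotient ascent p531707) proved the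
`⊇`-half of Thm. 5.4 in the kernel, in the form `span_sup_span_le_cohomologyAnnihilator_planeCurve_neg_of_le :
(z,t)²·C ≤ ca(C) ⇒ (v̄, ū) ⊔ ((z²)‾, (zt)‾, (t²)‾) ≤ ca(T_{−h})`.  This file re-assembles the descent with that input:

* `span_le_cohomologyAnnihilator_of_isLocalization_of_le` — K2-LOWER for `A′ = k[z,t,u,v]/(u² + v² − h)` at the origin from an
  ABSTRACT completed-stage bound `hT : (v̄, ū) ⊔ ((z²)‾, (zt)‾, (t²)‾) ≤ ca(T_{−h})` (faithfully flat descent `L → L^ ≅ T_{−h}`,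
  verbatim from p530272 with `hT` in place of the fact);
* `kc3OriginXY_isMaximal` / `kc3OriginXY_isPrime` — the origin of `A` is maximal (`h(0) = 0`), exported for consumers;
* `span_le_cohomologyAnnihilator_of_isLocalization_xy_of_forall` — the `x = u + iv, y = u − iv` TRANSFER as a standalone
  implication: the `A′`-form of K2-LOWER (for all local rings of `A′` at the origin) implies the `A`-form (plumbing verbatim from
  p532075);
* **`span_le_cohomologyAnnihilator_of_isLocalization_xy_of_le`** — K2-LOWER for `A = k[x,y,z,t]/(xy − h)`:
  hypotheses `ringChar k ≠ 2`, `i² = −1`, `h(0) = 0`, `h ≠ 0` and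
  `hJ : ((z,t)²)·C ≤ ca(C)` for `C = k⟦z,t⟧/(h)` ONLY; conclusion `(x̄, ȳ, z̄², z̄t̄, t̄²)·L ≤ ca(L)` for every localization `L`
  of `A` at the origin;  `…_localizationAtPrime_xy_of_le` — the instance `L = A_𝔬`;
* (rev 2) `span_le_cohomologyAnnihilator_of_isLocalization_cusp34_of_le` — the instance at the curve of record `h = z³ + t⁴`
  (`constantCoeff_cusp34`, `cusp34_ne_zero`, `coe_cusp34`, `kc3PolyXY_cusp34`), `hJ` in res-L1-w44b-stub-1's spelling.

For the cusp `h = z³ + t⁴`, `hJ` is res-L1-w44b-stub-1's `span_sq_le_cohomologyAnnihilator_cusp34` (normalisation `C ↪ k⟦s⟧`,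
image `⊇ s⁶k⟦s⟧`, conductor elements `z², zt, t²`, and `…ConductorStablyAnnihilates.mem_cohomologyAnnihilator_of_conductor` p533636 /
res-L1-w44b-stub-2's `…ConductorStable` p532769) — consumed BY NAME by the K5 assembly, not here.  (res-L1-w44b-stub-2's AFFINE route
`…PersistenceKC3Lower` reaches the same inclusion without completion; the two are independent kernel derivations.)
Filed `--supports stmt-ResolutionOfSingularities-16484 --as helper`.
-/

noncomputable section

-- single-problem summit: the doubled namespace component `ResolutionOfSingularities` is forced
set_option linter.dupNamespace false

namespace Summit.ResolutionOfSingularities.ResolutionOfSingularities.Theorems.HomologicalConductor.PersistenceKC3LowerFactFree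

open IsLocalRing Literature.RingTheory.CohomologyAnnihilator Literature.AlgebraicGeometry.Resolution
open Summit.ResolutionOfSingularities.ResolutionOfSingularities.Theorems.HomologicalConductor.PersistenceKC3Completion
open Summit.ResolutionOfSingularities.ResolutionOfSingularities.Theorems.HomologicalConductor.PersistenceFaithfullyFlatDescentCompletion
open Summit.ResolutionOfSingularities.ResolutionOfSingularities.Theorems.HomologicalConductor.PersistenceBranchedCoverIterate
open Summit.ResolutionOfSingularities.ResolutionOfSingularities.Theorems.HomologicalConductor.PersistenceBranchedCoverLift

universe u

/-! ## K2-LOWER for `A′ = k[z,t,u,v]/(u² + v² − h)` from an abstract completed-stage bound -/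

/-- **K2-LOWER AT THE ALGEBRAIC LOCAL RING FROM A T-LEVEL BOUND**: same conclusion as
`PersistenceKC3Completion.span_le_cohomologyAnnihilator_of_isLocalization`, but the hypothesis is directly the completed-stage
bound `hT : (v̄, ū) ⊔ ((CC z²)‾, (CC zt)‾, (CC t²)‾) ≤ ca(T_{−h})` (supplied without any print fact by
`PersistenceBranchedCoverLift.span_sup_span_le_cohomologyAnnihilator_planeCurve_neg_of_le`).  Proof = faithfully flat descent
along `L → L^ ≅ T_{−h}` (`exists_ringEquiv_completion_values`, `faithfullyFlat_adicCompletion`,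
`comap_cohomologyAnnihilator_le_of_faithfullyFlat'`). [OURS] -/
theorem span_le_cohomologyAnnihilator_of_isLocalization_of_le (k : Type u) [Field k]
    (hP : MvPolynomial (Fin 2) k) (h0 : MvPolynomial.constantCoeff hP = 0)
    (hT : Ideal.span {Ideal.Quotient.mk (Ideal.span {(PowerSeries.C (PowerSeries.C (-(hP : MvPowerSeries (Fin 2) k)) +
            PowerSeries.X ^ 2 : PowerSeries (MvPowerSeries (Fin 2) k)) + PowerSeries.X ^ 2 :
            PowerSeries (PowerSeries (MvPowerSeries (Fin 2) k)))}) PowerSeries.X,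
          Ideal.Quotient.mk (Ideal.span {(PowerSeries.C (PowerSeries.C (-(hP : MvPowerSeries (Fin 2) k)) +
            PowerSeries.X ^ 2 : PowerSeries (MvPowerSeries (Fin 2) k)) + PowerSeries.X ^ 2 :
            PowerSeries (PowerSeries (MvPowerSeries (Fin 2) k)))}) (PowerSeries.C PowerSeries.X)} ⊔
      Ideal.span {Ideal.Quotient.mk (Ideal.span {(PowerSeries.C (PowerSeries.C (-(hP : MvPowerSeries (Fin 2) k)) +
            PowerSeries.X ^ 2 : PowerSeries (MvPowerSeries (Fin 2) k)) + PowerSeries.X ^ 2 :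
            PowerSeries (PowerSeries (MvPowerSeries (Fin 2) k)))}) (PowerSeries.C (PowerSeries.C (MvPowerSeries.X 0 ^ 2))),
          Ideal.Quotient.mk (Ideal.span {(PowerSeries.C (PowerSeries.C (-(hP : MvPowerSeries (Fin 2) k)) +
            PowerSeries.X ^ 2 : PowerSeries (MvPowerSeries (Fin 2) k)) + PowerSeries.X ^ 2 :
            PowerSeries (PowerSeries (MvPowerSeries (Fin 2) k)))})
            (PowerSeries.C (PowerSeries.C (MvPowerSeries.X 0 * MvPowerSeries.X 1))),
          Ideal.Quotient.mk (Ideal.span {(PowerSeries.C (PowerSeries.C (-(hP : MvPowerSeries (Fin 2) k)) +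
            PowerSeries.X ^ 2 : PowerSeries (MvPowerSeries (Fin 2) k)) + PowerSeries.X ^ 2 :
            PowerSeries (PowerSeries (MvPowerSeries (Fin 2) k)))}) (PowerSeries.C (PowerSeries.C (MvPowerSeries.X 1 ^ 2)))} ≤
      cohomologyAnnihilator (BranchedCover (PowerSeries (MvPowerSeries (Fin 2) k))
        (PowerSeries.C (-(hP : MvPowerSeries (Fin 2) k)) + PowerSeries.X ^ 2 : PowerSeries (MvPowerSeries (Fin 2) k)) 2))
    (L : Type u) [CommRing L] [IsLocalRing L] [Algebra (KC3Ring k hP) L] [(kc3Origin k hP).IsPrime]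
    [IsLocalization.AtPrime L (kc3Origin k hP)] :
    Ideal.span {algebraMap (KC3Ring k hP) L (Ideal.Quotient.mk _ (MvPolynomial.X 2)),
        algebraMap (KC3Ring k hP) L (Ideal.Quotient.mk _ (MvPolynomial.X 3)),
        algebraMap (KC3Ring k hP) L (Ideal.Quotient.mk _ (MvPolynomial.X 0 ^ 2)),
        algebraMap (KC3Ring k hP) L (Ideal.Quotient.mk _ (MvPolynomial.X 0 * MvPolynomial.X 1)),
        algebraMap (KC3Ring k hP) L (Ideal.Quotient.mk _ (MvPolynomial.X 1 ^ 2))} ≤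
      cohomologyAnnihilator L := by
  haveI : IsNoetherianRing L :=
    IsLocalization.isNoetherianRing (kc3Origin k hP).primeCompl L inferInstance
  haveI := faithfullyFlat_adicCompletion L
  obtain ⟨e, h3, h2, h00, h01, h11⟩ := exists_ringEquiv_completion_values k hP h0 L
  -- descent along `L → L^ ≅ T_{−h}`
  have key : ∀ x : L, e (algebraMap L (AdicCompletion (maximalIdeal L) L) x) ∈
      cohomologyAnnihilator (BranchedCover (PowerSeries (MvPowerSeries (Fin 2) k))
        (PowerSeries.C (-(hP : MvPowerSeries (Fin 2) k)) + PowerSeries.X ^ 2 : PowerSeries (MvPowerSeries (Fin 2) k)) 2) →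
      x ∈ cohomologyAnnihilator L := fun x hx => by
    apply comap_cohomologyAnnihilator_le_of_faithfullyFlat' (S := AdicCompletion (maximalIdeal L) L)
    rw [Ideal.mem_comap, cohomologyAnnihilator_eq_comap_ringEquiv e, Ideal.mem_comap]
    exact hx
  rw [Ideal.span_le]
  rintro x hx
  simp only [Set.mem_insert_iff, Set.mem_singleton_iff] at hx
  rw [SetLike.mem_coe]
  rcases hx with rfl | rfl | rfl | rfl | rfl
  · exact key _ (by rw [h2]; exact hT (Ideal.mem_sup_left (Ideal.subset_span (by simp))))
  · exact key _ (by rw [h3]; exact hT (Ideal.mem_sup_left (Ideal.subset_span (by simp))))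
  · exact key _ (by rw [h00]; exact hT (Ideal.mem_sup_right (Ideal.subset_span (by simp))))
  · exact key _ (by rw [h01]; exact hT (Ideal.mem_sup_right (Ideal.subset_span (by simp))))
  · exact key _ (by rw [h11]; exact hT (Ideal.mem_sup_right (Ideal.subset_span (by simp))))

/-! ## The origin of `A = k[x,y,z,t]/(xy − h)` is maximal -/

/-- The origin `𝔬 = (x̄, ȳ, z̄, t̄)` of `A = k[x,y,z,t]/(xy − h)` (`kc3OriginXY`) is a maximal ideal when `h(0) = 0`
(same argument as `PersistenceKC3Completion.kc3Origin_isMaximal`: the origin of `k[x,y,z,t]` is maximal and contains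
`xy − h`, `kc3PolyXY_mem_originIdeal`).  Exported so that consumers can form `Localization.AtPrime (kc3OriginXY k hP)` and
discharge the `IsPrime` instance of the K2-LOWER theorems. [folklore] -/
theorem kc3OriginXY_isMaximal {k : Type u} [Field k] {hP : MvPolynomial (Fin 2) k}
    (h0 : MvPolynomial.constantCoeff hP = 0) : (kc3OriginXY k hP).IsMaximal := by
  rcases Ideal.map_eq_top_or_isMaximal_of_surjective (Ideal.Quotient.mk (Ideal.span {kc3PolyXY k hP}))
    Ideal.Quotient.mk_surjective (originIdeal.isMaximal k 4) with h | h
  · exfalso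
    have hc := congrArg (Ideal.comap (Ideal.Quotient.mk (Ideal.span {kc3PolyXY k hP}))) h
    rw [Ideal.comap_map_of_surjective _ Ideal.Quotient.mk_surjective, Ideal.comap_top, ← RingHom.ker_eq_comap_bot,
      Ideal.mk_ker, sup_eq_left.mpr ((Ideal.span_singleton_le_iff_mem _).mpr (kc3PolyXY_mem_originIdeal h0))] at hc
    exact (originIdeal.isMaximal k 4).ne_top hc
  · exact h

/-- The origin of `A` is prime (instance form of `kc3OriginXY_isMaximal`, for `Localization.AtPrime`). [folklore] -/
theorem kc3OriginXY_isPrime {k : Type u} [Field k] {hP : MvPolynomial (Fin 2) k}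
    (h0 : MvPolynomial.constantCoeff hP = 0) : (kc3OriginXY k hP).IsPrime :=
  (kc3OriginXY_isMaximal h0).isPrime

/-! ## The `xy`-transfer as a standalone implication -/

-- same budget as the tree copy of the twin `…_of_isLocalization_xy` (buildfix p535223): the transfer plumbing is heartbeat-heavy
set_option maxHeartbeats 400000 in
/-- **TRANSFER `A′ → A`** (`x = u + iv`, `y = u − iv`, `i² = −1`, `2 ≠ 0`): if K2-LOWER holds at EVERY local ring of
`A′ = k[z,t,u,v]/(u² + v² − h)` at the origin (generators `u, v, z², zt, t²`), then it holds at every local ring of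
`A = k[x,y,z,t]/(xy − h)` at the origin (generators `x, y, z², zt, t²`).  The plumbing (`exists_xyEquiv`, the induced
`ψ : A ≃+* A′` fixing the origin, `IsLocalization.isLocalization_of_base_ringEquiv`) is that of
`PersistenceKC3Completion.span_le_cohomologyAnnihilator_of_isLocalization_xy`, with the `A′`-statement as a hypothesis. [OURS] -/
theorem span_le_cohomologyAnnihilator_of_isLocalization_xy_of_forall (k : Type u) [Field k] (h2 : (2 : k) ≠ 0)
    (i : k) (hi : i ^ 2 = -1) (hP : MvPolynomial (Fin 2) k) (h0 : MvPolynomial.constantCoeff hP = 0)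
    (H : ∀ (L : Type u) [CommRing L] [IsLocalRing L] [Algebra (KC3Ring k hP) L] [(kc3Origin k hP).IsPrime]
      [IsLocalization.AtPrime L (kc3Origin k hP)],
      Ideal.span {algebraMap (KC3Ring k hP) L (Ideal.Quotient.mk _ (MvPolynomial.X 2)),
          algebraMap (KC3Ring k hP) L (Ideal.Quotient.mk _ (MvPolynomial.X 3)),
          algebraMap (KC3Ring k hP) L (Ideal.Quotient.mk _ (MvPolynomial.X 0 ^ 2)),
          algebraMap (KC3Ring k hP) L (Ideal.Quotient.mk _ (MvPolynomial.X 0 * MvPolynomial.X 1)),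
          algebraMap (KC3Ring k hP) L (Ideal.Quotient.mk _ (MvPolynomial.X 1 ^ 2))} ≤
        cohomologyAnnihilator L)
    (L : Type u) [CommRing L] [IsLocalRing L] [Algebra (KC3RingXY k hP) L] [(kc3OriginXY k hP).IsPrime]
    [IsLocalization.AtPrime L (kc3OriginXY k hP)] :
    Ideal.span {algebraMap (KC3RingXY k hP) L (Ideal.Quotient.mk _ (MvPolynomial.X 0)),
        algebraMap (KC3RingXY k hP) L (Ideal.Quotient.mk _ (MvPolynomial.X 1)),
        algebraMap (KC3RingXY k hP) L (Ideal.Quotient.mk _ (MvPolynomial.X 2 ^ 2)),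
        algebraMap (KC3RingXY k hP) L (Ideal.Quotient.mk _ (MvPolynomial.X 2 * MvPolynomial.X 3)),
        algebraMap (KC3RingXY k hP) L (Ideal.Quotient.mk _ (MvPolynomial.X 3 ^ 2))} ≤
      cohomologyAnnihilator L := by
  obtain ⟨φ, hφ, hφs, hφf⟩ := exists_xyEquiv hi h2 hP
  -- the underlying ring isomorphism and the induced isomorphism of the quotients `ψ : A ≃+* A′`
  let φr : MvPolynomial (Fin 4) k ≃+* MvPolynomial (Fin 4) k := φ.toRingEquiv
  have hφr : ∀ p, φr p = φ p := fun _ => rfl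
  have hIJ : Ideal.span {kc3Poly k hP} =
      (Ideal.span {kc3PolyXY k hP}).map (φr : MvPolynomial (Fin 4) k →+* MvPolynomial (Fin 4) k) := by
    rw [Ideal.map_span, Set.image_singleton, RingHom.coe_coe, hφr, hφf]
  let ψ : KC3RingXY k hP ≃+* KC3Ring k hP :=
    Ideal.quotientEquiv (Ideal.span {kc3PolyXY k hP}) (Ideal.span {kc3Poly k hP}) φr hIJ
  have hψ : ∀ p, ψ (Ideal.Quotient.mk _ p) = Ideal.Quotient.mk _ (φ p) := fun p =>
    Ideal.quotientEquiv_mk _ _ φr hIJ p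
  have hψs : ∀ p, ψ.symm (Ideal.Quotient.mk _ p) = Ideal.Quotient.mk _ (φ.symm p) := fun p =>
    Ideal.quotientEquiv_symm_mk _ _ φr hIJ p
  -- `ψ` carries the origin to the origin
  have hφ0 : ∀ p : MvPolynomial (Fin 4) k, p ∈ originIdeal k 4 → φ p ∈ originIdeal k 4 := by
    intro p hp
    rw [mem_originIdeal_iff] at hp ⊢
    -- `constantCoeff ∘ φ = constantCoeff` (both kill the variables)
    have hcomp : (MvPolynomial.constantCoeff : MvPolynomial (Fin 4) k →+* k).comp (φ : MvPolynomial (Fin 4) k →+* _) =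
        MvPolynomial.constantCoeff := by
      refine MvPolynomial.ringHom_ext (fun a => ?_) (fun j => ?_)
      · change MvPolynomial.constantCoeff (φ (algebraMap k _ a)) = _
        rw [AlgEquiv.commutes, MvPolynomial.algebraMap_eq, MvPolynomial.constantCoeff_C]
      · rw [RingHom.comp_apply, RingHom.coe_coe, hφ, MvPolynomial.constantCoeff_X]
        fin_cases j
        · show MvPolynomial.constantCoeff (xyFwd k i 0) = 0
          rw [xyFwd_zero, map_add, map_mul, MvPolynomial.constantCoeff_X, MvPolynomial.constantCoeff_X, mul_zero, add_zero]
        · show MvPolynomial.constantCoeff (xyFwd k i 1) = 0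
          rw [xyFwd_one, map_sub, map_mul, MvPolynomial.constantCoeff_X, MvPolynomial.constantCoeff_X, mul_zero, sub_zero]
        · show MvPolynomial.constantCoeff (xyFwd k i 2) = 0
          rw [xyFwd_two, MvPolynomial.constantCoeff_X]
        · show MvPolynomial.constantCoeff (xyFwd k i 3) = 0
          rw [xyFwd_three, MvPolynomial.constantCoeff_X]
    have := congrArg (fun g => g p) hcomp
    simp only [RingHom.comp_apply, RingHom.coe_coe] at this
    rw [this, hp]
  have hφs0 : ∀ p : MvPolynomial (Fin 4) k, p ∈ originIdeal k 4 → φ.symm p ∈ originIdeal k 4 := by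
    intro p hp
    rw [mem_originIdeal_iff] at hp ⊢
    have hcomp : (MvPolynomial.constantCoeff : MvPolynomial (Fin 4) k →+* k).comp (φ.symm : MvPolynomial (Fin 4) k →+* _) =
        MvPolynomial.constantCoeff := by
      refine MvPolynomial.ringHom_ext (fun a => ?_) (fun j => ?_)
      · change MvPolynomial.constantCoeff (φ.symm (algebraMap k _ a)) = _
        rw [AlgEquiv.commutes, MvPolynomial.algebraMap_eq, MvPolynomial.constantCoeff_C]
      · rw [RingHom.comp_apply, RingHom.coe_coe, hφs, MvPolynomial.constantCoeff_X]
        fin_cases j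
        · show MvPolynomial.constantCoeff (xyBwd k i 0) = 0
          rw [xyBwd_zero, MvPolynomial.constantCoeff_X]
        · show MvPolynomial.constantCoeff (xyBwd k i 1) = 0
          rw [xyBwd_one, MvPolynomial.constantCoeff_X]
        · show MvPolynomial.constantCoeff (xyBwd k i 2) = 0
          rw [xyBwd_two, map_mul, map_add, MvPolynomial.constantCoeff_X, MvPolynomial.constantCoeff_X, add_zero, mul_zero]
        · show MvPolynomial.constantCoeff (xyBwd k i 3) = 0
          rw [xyBwd_three, map_mul, map_sub, MvPolynomial.constantCoeff_X, MvPolynomial.constantCoeff_X, sub_zero, mul_zero]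
    have := congrArg (fun g => g p) hcomp
    simp only [RingHom.comp_apply, RingHom.coe_coe] at this
    rw [this, hp]
  have hO : (kc3OriginXY k hP).map (ψ : KC3RingXY k hP →+* KC3Ring k hP) = kc3Origin k hP := by
    apply le_antisymm
    · rw [kc3OriginXY, Ideal.map_map, Ideal.map_le_iff_le_comap]
      intro p hp
      rw [Ideal.mem_comap, RingHom.comp_apply, RingHom.coe_coe, hψ]
      exact Ideal.mem_map_of_mem _ (hφ0 p hp)
    · rw [kc3Origin, Ideal.map_le_iff_le_comap]
      intro p hp
      rw [Ideal.mem_comap]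
      have : Ideal.Quotient.mk (Ideal.span {kc3Poly k hP}) p = ψ (Ideal.Quotient.mk _ (φ.symm p)) := by
        rw [hψ, AlgEquiv.apply_symm_apply]
      rw [this]
      exact Ideal.mem_map_of_mem _ (Ideal.mem_map_of_mem _ (hφs0 p hp))
  -- `L` as an `A′`-algebra through `ψ`, a localization at the origin of `A′`
  letI : Algebra (KC3Ring k hP) L := ((algebraMap (KC3RingXY k hP) L).comp ψ.symm.toRingHom).toAlgebra
  haveI hprime : (kc3Origin k hP).IsPrime := (kc3Origin_isMaximal (k := k) (hP := hP) h0).isPrime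
  have hψsurj : Function.Surjective (ψ : KC3RingXY k hP →+* KC3Ring k hP) := ψ.surjective
  have hM : ((kc3OriginXY k hP).primeCompl).map ψ = (kc3Origin k hP).primeCompl := by
    ext b
    rw [Submonoid.mem_map]
    constructor
    · rintro ⟨a, ha, rfl⟩
      change a ∉ kc3OriginXY k hP at ha
      change ψ a ∉ kc3Origin k hP
      intro hb
      apply ha
      rw [← hO] at hb
      obtain ⟨a', ha', he⟩ := (Ideal.mem_map_iff_of_surjective _ hψsurj).mp hb
      rw [RingHom.coe_coe] at he
      rwa [← ψ.injective he]
    · intro hb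
      change b ∉ kc3Origin k hP at hb
      refine ⟨ψ.symm b, fun ha => hb ?_, ψ.apply_symm_apply b⟩
      rw [← hO]
      have := Ideal.mem_map_of_mem (ψ : KC3RingXY k hP →+* KC3Ring k hP) ha
      rwa [RingHom.coe_coe, ψ.apply_symm_apply] at this
  haveI : IsLocalization.AtPrime L (kc3Origin k hP) := by
    have hloc := IsLocalization.isLocalization_of_base_ringEquiv ((kc3OriginXY k hP).primeCompl) L
      (ψ : KC3RingXY k hP ≃+* KC3Ring k hP)
    rw [hM] at hloc
    exact hloc
  have key := H L
  -- every generator of `A` is `φ⁻¹` of a polynomial; go through `φ`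
  have hback : ∀ p : MvPolynomial (Fin 4) k,
      algebraMap (KC3RingXY k hP) L (Ideal.Quotient.mk _ p) = algebraMap (KC3Ring k hP) L (Ideal.Quotient.mk _ (φ p)) := by
    intro p
    change _ = algebraMap (KC3RingXY k hP) L (ψ.symm (Ideal.Quotient.mk _ (φ p)))
    rw [hψs, AlgEquiv.symm_apply_apply]
  rw [Ideal.span_le]
  rintro x hx
  simp only [Set.mem_insert_iff, Set.mem_singleton_iff] at hx
  rw [SetLike.mem_coe]
  rcases hx with rfl | rfl | rfl | rfl | rfl
  · rw [hback, hφ, xyFwd_zero, map_add, map_mul, map_add, map_mul]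
    exact Ideal.add_mem _ (key (Ideal.subset_span (by simp)))
      (Ideal.mul_mem_left _ _ (key (Ideal.subset_span (by simp))))
  · rw [hback, hφ, xyFwd_one, map_sub, map_mul, map_sub, map_mul]
    exact Ideal.sub_mem _ (key (Ideal.subset_span (by simp)))
      (Ideal.mul_mem_left _ _ (key (Ideal.subset_span (by simp))))
  · rw [hback, map_pow, hφ, xyFwd_two]
    exact key (Ideal.subset_span (by simp))
  · rw [hback, map_mul, hφ, hφ, xyFwd_two, xyFwd_three]
    exact key (Ideal.subset_span (by simp))
  · rw [hback, map_pow, hφ, xyFwd_three]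
    exact key (Ideal.subset_span (by simp))

/-! ## K2-LOWER for `A = k[x,y,z,t]/(xy − h)`: hypotheses `char k ≠ 2`, `i² = −1`, `hJ` only -/

/-- **K2-LOWER, FACT-FREE (modulo the curve-side bound)**: for a field `k` with `ringChar k ≠ 2` containing `i` with
`i² = −1`, a plane curve `0 ≠ h ∈ (z,t)k[z,t]`, and EVERY localization `L` of `A = k[x,y,z,t]/(xy − h)` at the origin:
if `((z,t)²)·C ≤ ca(C)` for the completed curve `C = k⟦z,t⟧/(h)`, then `(x̄, ȳ, z̄², z̄t̄, t̄²)·L ⊆ ca(L)`.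
Assembly: `span_sup_span_le_cohomologyAnnihilator_planeCurve_neg_of_le` (T-level bound, quotient ascent twice) →
`span_le_cohomologyAnnihilator_of_isLocalization_of_le` (faithfully flat descent to the local rings of `A′`) →
`span_le_cohomologyAnnihilator_of_isLocalization_xy_of_forall` (transfer `A′ → A`).  No named fact. [OURS] -/
theorem span_le_cohomologyAnnihilator_of_isLocalization_xy_of_le (k : Type u) [Field k] (hchar : ringChar k ≠ 2)
    (i : k) (hi : i ^ 2 = -1)
    (hP : MvPolynomial (Fin 2) k) (h0 : MvPolynomial.constantCoeff hP = 0) (hP0 : hP ≠ 0)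
    (hJ : ((Ideal.span {(MvPowerSeries.X 0 : MvPowerSeries (Fin 2) k), MvPowerSeries.X 1}) ^ 2).map
        (Ideal.Quotient.mk (Ideal.span {(hP : MvPowerSeries (Fin 2) k)})) ≤
      cohomologyAnnihilator (MvPowerSeries (Fin 2) k ⧸ Ideal.span {(hP : MvPowerSeries (Fin 2) k)}))
    (L : Type u) [CommRing L] [IsLocalRing L] [Algebra (KC3RingXY k hP) L] [(kc3OriginXY k hP).IsPrime]
    [IsLocalization.AtPrime L (kc3OriginXY k hP)] :
    Ideal.span {algebraMap (KC3RingXY k hP) L (Ideal.Quotient.mk _ (MvPolynomial.X 0)),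
        algebraMap (KC3RingXY k hP) L (Ideal.Quotient.mk _ (MvPolynomial.X 1)),
        algebraMap (KC3RingXY k hP) L (Ideal.Quotient.mk _ (MvPolynomial.X 2 ^ 2)),
        algebraMap (KC3RingXY k hP) L (Ideal.Quotient.mk _ (MvPolynomial.X 2 * MvPolynomial.X 3)),
        algebraMap (KC3RingXY k hP) L (Ideal.Quotient.mk _ (MvPolynomial.X 3 ^ 2))} ≤
      cohomologyAnnihilator L := by
  have hT := span_sup_span_le_cohomologyAnnihilator_planeCurve_neg_of_le k hchar (hP : MvPowerSeries (Fin 2) k)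
    (fun h => hP0 (MvPolynomial.coe_eq_zero_iff.mp h)) hJ
  exact span_le_cohomologyAnnihilator_of_isLocalization_xy_of_forall k (Ring.two_ne_zero hchar) i hi hP h0
    (fun L' _ _ _ _ _ => span_le_cohomologyAnnihilator_of_isLocalization_of_le k hP h0 hT L') L

/-- The same at the STANDARD local ring `Localization.AtPrime 𝔬` of `A = k[x,y,z,t]/(xy − h)` at the origin
(`𝔬` prime by `kc3OriginXY_isPrime h0`). [OURS] -/
theorem span_le_cohomologyAnnihilator_localizationAtPrime_xy_of_le (k : Type u) [Field k] (hchar : ringChar k ≠ 2)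
    (i : k) (hi : i ^ 2 = -1)
    (hP : MvPolynomial (Fin 2) k) (h0 : MvPolynomial.constantCoeff hP = 0) (hP0 : hP ≠ 0)
    (hJ : ((Ideal.span {(MvPowerSeries.X 0 : MvPowerSeries (Fin 2) k), MvPowerSeries.X 1}) ^ 2).map
        (Ideal.Quotient.mk (Ideal.span {(hP : MvPowerSeries (Fin 2) k)})) ≤
      cohomologyAnnihilator (MvPowerSeries (Fin 2) k ⧸ Ideal.span {(hP : MvPowerSeries (Fin 2) k)})) :
    haveI := kc3OriginXY_isPrime h0
    Ideal.span {algebraMap (KC3RingXY k hP) (Localization.AtPrime (kc3OriginXY k hP)) (Ideal.Quotient.mk _ (MvPolynomial.X 0)),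
        algebraMap (KC3RingXY k hP) (Localization.AtPrime (kc3OriginXY k hP)) (Ideal.Quotient.mk _ (MvPolynomial.X 1)),
        algebraMap (KC3RingXY k hP) (Localization.AtPrime (kc3OriginXY k hP)) (Ideal.Quotient.mk _ (MvPolynomial.X 2 ^ 2)),
        algebraMap (KC3RingXY k hP) (Localization.AtPrime (kc3OriginXY k hP))
          (Ideal.Quotient.mk _ (MvPolynomial.X 2 * MvPolynomial.X 3)),
        algebraMap (KC3RingXY k hP) (Localization.AtPrime (kc3OriginXY k hP)) (Ideal.Quotient.mk _ (MvPolynomial.X 3 ^ 2))} ≤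
      cohomologyAnnihilator (Localization.AtPrime (kc3OriginXY k hP)) := by
  haveI := kc3OriginXY_isPrime h0
  exact span_le_cohomologyAnnihilator_of_isLocalization_xy_of_le k hchar i hi hP h0 hP0 hJ
    (Localization.AtPrime (kc3OriginXY k hP))

/-! ## The cusp instance `h = z³ + t⁴` (rev 2): side goals discharged, `hJ` in res-L1-w44b-stub-1's spelling -/

/-- The K-C3 curve of record as a POLYNOMIAL: `h₃₄ = z³ + t⁴ ∈ k[z,t]` (`z = X 0`, `t = X 1`). [this work] -/
theorem constantCoeff_cusp34 (k : Type u) [Field k] :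
    MvPolynomial.constantCoeff (MvPolynomial.X 0 ^ 3 + MvPolynomial.X 1 ^ 4 : MvPolynomial (Fin 2) k) = 0 := by
  simp [MvPolynomial.constantCoeff_X]

/-- `z³ + t⁴ ≠ 0` in `k[z,t]` (it takes the value `1` at `(1, 0)`). [this work] -/
theorem cusp34_ne_zero (k : Type u) [Field k] :
    (MvPolynomial.X 0 ^ 3 + MvPolynomial.X 1 ^ 4 : MvPolynomial (Fin 2) k) ≠ 0 := by
  intro h
  have := congrArg (MvPolynomial.eval (![1, 0] : Fin 2 → k)) h
  simp [MvPolynomial.eval_X] at this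

/-- The coercion of `z³ + t⁴` to `k⟦z,t⟧` is res-L1-w44b-stub-1's series `X 0 ^ 3 + X 1 ^ 4` (`Cusp34Normalisation`). [this work] -/
theorem coe_cusp34 (k : Type u) [Field k] :
    ((MvPolynomial.X 0 ^ 3 + MvPolynomial.X 1 ^ 4 : MvPolynomial (Fin 2) k) : MvPowerSeries (Fin 2) k) =
      MvPowerSeries.X 0 ^ 3 + MvPowerSeries.X 1 ^ 4 := by
  rw [MvPolynomial.coe_add, MvPolynomial.coe_pow, MvPolynomial.coe_pow, MvPolynomial.coe_X, MvPolynomial.coe_X]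

/-- The defining polynomial of `A` at the cusp: `kc3PolyXY k (z³ + t⁴) = xy − (z³ + t⁴)` with `x, y, z, t = X 0, X 1, X 2, X 3`
(so res-type-010's `f₀ = X 0 * X 1 - X 2 ^ 3 - X 3 ^ 4` is the same polynomial by `ring`). [this work] -/
theorem kc3PolyXY_cusp34 (k : Type u) [Field k] :
    kc3PolyXY k (MvPolynomial.X 0 ^ 3 + MvPolynomial.X 1 ^ 4) =
      (MvPolynomial.X 0 * MvPolynomial.X 1 - (MvPolynomial.X 2 ^ 3 + MvPolynomial.X 3 ^ 4) : MvPolynomial (Fin 4) k) := by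
  rw [kc3PolyXY, map_add, map_pow, map_pow, MvPolynomial.rename_X, MvPolynomial.rename_X]
  rfl

/-- **K2-LOWER AT THE CUSP `h = z³ + t⁴`, FACT-FREE modulo `hJ`** — the instance of
`span_le_cohomologyAnnihilator_of_isLocalization_xy_of_le` at the K-C3 curve of record, with `h(0) = 0` and `h ≠ 0` discharged and
the curve-side bound `hJ` taken in res-L1-w44b-stub-1's spelling `Ideal.span {(X 0 ^ 3 + X 1 ^ 4 : MvPowerSeries (Fin 2) k)}`
(their `span_sq_le_cohomologyAnnihilator_cusp34`-to-be): for every localization `L` of `A = k[x,y,z,t]/(xy − z³ − t⁴)` at the origin,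
`(x̄, ȳ, z̄², z̄t̄, t̄²)·L ⊆ ca(L)`.  Remaining hypotheses: `ringChar k ≠ 2`, `i² = −1`, `hJ`. [OURS] -/
theorem span_le_cohomologyAnnihilator_of_isLocalization_cusp34_of_le (k : Type u) [Field k] (hchar : ringChar k ≠ 2)
    (i : k) (hi : i ^ 2 = -1)
    (hJ : ((Ideal.span {(MvPowerSeries.X 0 : MvPowerSeries (Fin 2) k), MvPowerSeries.X 1}) ^ 2).map
        (Ideal.Quotient.mk (Ideal.span {(MvPowerSeries.X 0 ^ 3 + MvPowerSeries.X 1 ^ 4 : MvPowerSeries (Fin 2) k)})) ≤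
      cohomologyAnnihilator (MvPowerSeries (Fin 2) k ⧸
        Ideal.span {(MvPowerSeries.X 0 ^ 3 + MvPowerSeries.X 1 ^ 4 : MvPowerSeries (Fin 2) k)}))
    (L : Type u) [CommRing L] [IsLocalRing L]
    [Algebra (KC3RingXY k (MvPolynomial.X 0 ^ 3 + MvPolynomial.X 1 ^ 4)) L]
    [(kc3OriginXY k (MvPolynomial.X 0 ^ 3 + MvPolynomial.X 1 ^ 4)).IsPrime]
    [IsLocalization.AtPrime L (kc3OriginXY k (MvPolynomial.X 0 ^ 3 + MvPolynomial.X 1 ^ 4))] :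
    Ideal.span {algebraMap (KC3RingXY k (MvPolynomial.X 0 ^ 3 + MvPolynomial.X 1 ^ 4)) L (Ideal.Quotient.mk _ (MvPolynomial.X 0)),
        algebraMap (KC3RingXY k (MvPolynomial.X 0 ^ 3 + MvPolynomial.X 1 ^ 4)) L (Ideal.Quotient.mk _ (MvPolynomial.X 1)),
        algebraMap (KC3RingXY k (MvPolynomial.X 0 ^ 3 + MvPolynomial.X 1 ^ 4)) L (Ideal.Quotient.mk _ (MvPolynomial.X 2 ^ 2)),
        algebraMap (KC3RingXY k (MvPolynomial.X 0 ^ 3 + MvPolynomial.X 1 ^ 4)) L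
          (Ideal.Quotient.mk _ (MvPolynomial.X 2 * MvPolynomial.X 3)),
        algebraMap (KC3RingXY k (MvPolynomial.X 0 ^ 3 + MvPolynomial.X 1 ^ 4)) L (Ideal.Quotient.mk _ (MvPolynomial.X 3 ^ 2))} ≤
      cohomologyAnnihilator L := by
  refine span_le_cohomologyAnnihilator_of_isLocalization_xy_of_le k hchar i hi _ (constantCoeff_cusp34 k)
    (cusp34_ne_zero k) ?_ L
  rw [coe_cusp34]
  exact hJ

end Summit.ResolutionOfSingularities.ResolutionOfSingularities.Theorems.HomologicalConductor.PersistenceKC3LowerFactFree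

end
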